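import Mathlib.MeasureTheory.Measure.Portmanteau
import Literature.Probability.RandomPlanarGeometry.CurveSpace
import Summits.CriticalPhenomena.SAWScalingLimit.Theses.SAWRenewalTightness
import Summits.CriticalPhenomena.SAWScalingLimit.Theorems.SubseqIdentification.Negative.Necessity
import Summits.CriticalPhenomena.SAWScalingLimit.Theorems.SubseqIdentification.Negative.ProbabilityRedundant

/-!
# `stub_areaUpperOfLimit`: the continuum one-sided `r²` boundary area bound of a subsequential limit

Stub S5⁺ (one-sided limit passage) of the registered skeleton of the line `boundary-area-law`
(restriction reshape) for the crux `SubseqIdentification` (stmt-CriticalPhenomena-0783, route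
`SAWRenewalTightness`; primary decl `SAWParafermion.SubseqIdentification`).

If the critical `δℤ²` SAW laws of a Dobrushin domain `(D; a, b)`, pushed to `CurveClass ℂ` by
`γ ↦ γ.curve`, converge weakly (test-function form) to a probability measure `μ` along a mesh
sequence `s`, and the lattice UPPER rarity bound holds along the sequence (for every fixed
`0 < r ≤ ε₀`, eventually in `n`, `P_n[dist ≤ r] · ε₀² ≤ C · P_n[dist ≤ ε₀] · r²` in `ℝ≥0∞`), then
`μ[dist(x₀, trace) < r] ≤ C' r²` for `0 < r < r₀ := ε₀`, with `C' = C / ε₀²`.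

Proof (the upper half, verbatim, of the landed two-sided S5 `stub_areaLawOfLimit`): the laws are
probability measures eventually along the sequence
(`Negative.eventually_isProbabilityMeasure_of_tendsto`, from the `f ≡ 1` test integral); past that
index the image laws `ν n` are `ProbabilityMeasure`s converging to `μ`
(`ProbabilityMeasure.tendsto_iff_forall_integral_tendsto`, `integral_map`). The functional
`c ↦ dist(x₀, trace c)` is `1`-Lipschitz on `CurveClass ℂ` (`Curve.infDist_range_le`), so
`{dist < r}` is open, and the portmanteau inequality
`ProbabilityMeasure.le_liminf_measure_open_of_tendsto` gives
`μ(< r) ≤ liminf ν_n(< r) ≤ liminf ν_n(≤ r) ≤ C (r/ε₀)² · 1` using `P_n(≤ ε₀) ≤ 1`.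
No non-degeneracy hypothesis and no lower bound are needed.

No named fact is used; axioms `propext`, `Classical.choice`, `Quot.sound`.
-/

noncomputable section

open MeasureTheory Filter Topology Set
open scoped NNReal ENNReal BoundedContinuousFunction

namespace Summit.CriticalPhenomena.SAWScalingLimit.Theorems.SubseqIdentification.BoundaryAreaLaw

open Literature.Probability.RandomPlanarGeometry Literature.Probability.LatticeModels

/-- `c ↦ dist(x₀, trace c)` is `1`-Lipschitz for the reparametrisation distance on curve classes:
every point of one trace is within `dist c₁ c₂` of the other trace (`Curve.infDist_range_le`).
[folklore] -/
private theorem lipschitzWith_infDist_range_upper (z : ℂ) :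
    LipschitzWith 1 fun c : CurveClass ℂ => Metric.infDist z c.range := by
  -- adapted from `Literature.Barriers.CriticalPhenomena.SupercriticalSAW.lipschitzWith_infDist_range`
  refine LipschitzWith.of_le_add fun c₁ c₂ => ?_
  obtain ⟨γ₁, rfl⟩ := CurveClass.surjective_mk c₁
  obtain ⟨γ₂, rfl⟩ := CurveClass.surjective_mk c₂
  simp only [CurveClass.range_mk, CurveClass.dist_mk_mk]
  have key : ∀ ⦃y⦄, y ∈ γ₂.range → Metric.infDist z γ₁.range - dist γ₁ γ₂ ≤ dist z y := by
    rintro y ⟨t, rfl⟩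
    have h₁ := Curve.infDist_range_le γ₂ γ₁ t
    have h₂ := Metric.infDist_le_infDist_add_dist (s := γ₁.range) (x := z) (y := γ₂ t)
    rw [dist_comm γ₂ γ₁] at h₁
    linarith
  have h := (Metric.le_infDist γ₂.range_nonempty).2 key
  linarith

/-- **S5⁺ — UPPER AREA BOUND OF THE LIMIT (one-sided limit passage).**
If the pushed SAW laws converge weakly to a probability measure `μ` along `s → 0⁺` and the lattice
UPPER rarity bound holds along the sequence (cross-multiplied against the reference radius `ε₀`,
for every fixed `0 < r ≤ ε₀` eventually in `n`), then `μ[dist(x₀, trace) < r] ≤ C' r²` for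
`0 < r < r₀`. Portmanteau on the Polish `CurveClass ℂ`: `{dist < r}` is open for the `1`-Lipschitz
functional `c ↦ dist(x₀, trace c)`, and `P_n[dist ≤ ε₀] ≤ 1`; `r₀ = ε₀`, `C' = C/ε₀²`. No
non-degeneracy of `μ` at `x₀` is needed. [folklore] -/
theorem stub_areaUpperOfLimit :
    ∀ (D : DobrushinDomain) (a b : ℝ → Site 2) (s : ℕ → ℝ) (μ : Measure (CurveClass ℂ)) (x₀ : ℂ),
      Tendsto s atTop (𝓝[>] (0 : ℝ)) → IsProbabilityMeasure μ →
      (∀ f : CurveClass ℂ →ᵇ ℝ,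
        Tendsto (fun n => ∫ γ, f γ.curve ∂(SAW.law D.carrier (s n) (a (s n)) (b (s n))))
          atTop (𝓝 (∫ x, f x ∂μ))) →
      (∃ C ε₀ : ℝ, 0 < C ∧ 0 < ε₀ ∧ ∀ r : ℝ, 0 < r → r ≤ ε₀ → ∀ᶠ n in atTop,
          SAW.law D.carrier (s n) (a (s n)) (b (s n)) {γ | Metric.infDist x₀ γ.curve.range ≤ r} *
                ENNReal.ofReal (ε₀ ^ 2) ≤
              ENNReal.ofReal C *
                SAW.law D.carrier (s n) (a (s n)) (b (s n))
                    {γ | Metric.infDist x₀ γ.curve.range ≤ ε₀} *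
                  ENNReal.ofReal (r ^ 2)) →
      ∃ C r₀ : ℝ, 0 < r₀ ∧ ∀ r ∈ Set.Ioo (0 : ℝ) r₀,
        μ {γ | Metric.infDist x₀ γ.range < r} ≤ ENNReal.ofReal (C * r ^ 2) := by
  intro D a b s μ x₀ _ hμ hlim hlaw
  obtain ⟨C, ε₀, hC, hε₀, hlaw⟩ := hlaw
  haveI := hμ
  -- past some index `N` the SAW laws are probability measures (test integral of `f ≡ 1`)
  obtain ⟨N, hN⟩ := eventually_atTop.1
    (Negative.eventually_isProbabilityMeasure_of_tendsto (hlim 1))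
  have hN' : ∀ n, IsProbabilityMeasure
      (SAW.law D.carrier (s (n + N)) (a (s (n + N))) (b (s (n + N)))) :=
    fun n => hN _ (N.le_add_left n)
  -- the image probability measures on `CurveClass ℂ`
  let ν : ℕ → ProbabilityMeasure (CurveClass ℂ) := fun n =>
    ⟨(SAW.law D.carrier (s (n + N)) (a (s (n + N))) (b (s (n + N)))).map (fun γ => γ.curve),
      Measure.isProbabilityMeasure_map (SAW.DomainSAW.measurable_of_top _).aemeasurable⟩
  have hνapply : ∀ (n : ℕ) {S : Set (CurveClass ℂ)}, MeasurableSet S →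
      ((ν n : ProbabilityMeasure (CurveClass ℂ)) : Measure (CurveClass ℂ)) S =
        SAW.law D.carrier (s (n + N)) (a (s (n + N))) (b (s (n + N)))
          ((fun γ => γ.curve) ⁻¹' S) :=
    fun n S hS => Measure.map_apply (SAW.DomainSAW.measurable_of_top _) hS
  -- weak convergence of the image probability measures
  have hνlim : Tendsto ν atTop (𝓝 (⟨μ, hμ⟩ : ProbabilityMeasure (CurveClass ℂ))) := by
    refine ProbabilityMeasure.tendsto_iff_forall_integral_tendsto.2 fun f => ?_
    have h := (hlim f).comp (tendsto_add_atTop_nat N)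
    refine h.congr fun n => ?_
    change ∫ γ, f γ.curve ∂(SAW.law D.carrier (s (n + N)) (a (s (n + N))) (b (s (n + N)))) =
      ∫ x, f x ∂((SAW.law D.carrier (s (n + N)) (a (s (n + N))) (b (s (n + N)))).map
        (fun γ => γ.curve))
    exact (integral_map (SAW.DomainSAW.measurable_of_top _).aemeasurable
      f.continuous.aestronglyMeasurable).symm
  -- the event `{dist < r}` is open
  have hcont : Continuous fun c : CurveClass ℂ => Metric.infDist x₀ c.range :=
    (lipschitzWith_infDist_range_upper x₀).continuous
  have hopen : ∀ r : ℝ, IsOpen {c : CurveClass ℂ | Metric.infDist x₀ c.range < r} :=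
    fun r => isOpen_lt hcont continuous_const
  -- portmanteau (open sets)
  have hliminf : ∀ r : ℝ, μ {c | Metric.infDist x₀ c.range < r} ≤
      liminf (fun n => ((ν n : ProbabilityMeasure (CurveClass ℂ)) : Measure (CurveClass ℂ))
        {c | Metric.infDist x₀ c.range < r}) atTop :=
    fun r => ProbabilityMeasure.le_liminf_measure_open_of_tendsto hνlim (hopen r)
  -- the image measure of the open event is the lattice probability
  have hνlt : ∀ (n : ℕ) (r : ℝ),
      ((ν n : ProbabilityMeasure (CurveClass ℂ)) : Measure (CurveClass ℂ))
          {c | Metric.infDist x₀ c.range < r} =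
        SAW.law D.carrier (s (n + N)) (a (s (n + N))) (b (s (n + N)))
          {γ | Metric.infDist x₀ γ.curve.range < r} :=
    fun n r => hνapply n (hopen r).measurableSet
  refine ⟨C / ε₀ ^ 2, ε₀, hε₀, fun r hr => ?_⟩
  obtain ⟨hr0, hrε⟩ := hr
  -- the lattice upper bound at radius `r`, shifted to the index `n + N`
  have hev := (tendsto_add_atTop_nat N).eventually (hlaw r hr0 hrε.le)
  -- UPPER bound: `μ(< r) ≤ liminf ν_n(< r) ≤ C (r/ε₀)²`
  refine (hliminf r).trans (liminf_le_of_frequently_le' (Eventually.frequently ?_))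
  filter_upwards [hev] with n h1
  rw [hνlt n r]
  have hε₀2 : ENNReal.ofReal (ε₀ ^ 2) ≠ 0 := (ENNReal.ofReal_pos.2 (by positivity)).ne'
  calc SAW.law D.carrier (s (n + N)) (a (s (n + N))) (b (s (n + N)))
        {γ | Metric.infDist x₀ γ.curve.range < r}
      ≤ SAW.law D.carrier (s (n + N)) (a (s (n + N))) (b (s (n + N)))
          {γ | Metric.infDist x₀ γ.curve.range ≤ r} :=
        measure_mono fun γ (hγ : Metric.infDist x₀ γ.curve.range < r) =>
          show Metric.infDist x₀ γ.curve.range ≤ r from hγ.le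
    _ ≤ ENNReal.ofReal (C * r ^ 2) / ENNReal.ofReal (ε₀ ^ 2) := by
        rw [ENNReal.le_div_iff_mul_le (Or.inl hε₀2) (Or.inl ENNReal.ofReal_ne_top)]
        calc SAW.law D.carrier (s (n + N)) (a (s (n + N))) (b (s (n + N)))
                {γ | Metric.infDist x₀ γ.curve.range ≤ r} * ENNReal.ofReal (ε₀ ^ 2)
            ≤ ENNReal.ofReal C *
                SAW.law D.carrier (s (n + N)) (a (s (n + N))) (b (s (n + N)))
                  {γ | Metric.infDist x₀ γ.curve.range ≤ ε₀} * ENNReal.ofReal (r ^ 2) := h1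
          _ ≤ ENNReal.ofReal C * 1 * ENNReal.ofReal (r ^ 2) := by
              gcongr
              exact prob_le_one
          _ = ENNReal.ofReal (C * r ^ 2) := by rw [mul_one, ENNReal.ofReal_mul hC.le]
    _ = ENNReal.ofReal (C / ε₀ ^ 2 * r ^ 2) := by
        rw [← ENNReal.ofReal_div_of_pos (by positivity)]
        congr 1
        ring

end Summit.CriticalPhenomena.SAWScalingLimit.Theorems.SubseqIdentification.BoundaryAreaLaw

end
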